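import Literature.MathematicalPhysics.QuantumFieldTheory.Balaban1983to89.B15AveragingAnalytic
import Literature.MathematicalPhysics.QuantumFieldTheory.Balaban1983to89.B15Prop1StateChartSU2
import Literature.MathematicalPhysics.QuantumFieldTheory.Balaban1983to89.Node00.MultiScaleFibreChart

/-!
# `Balaban1983to89.B15Prop1DatumCoordinates` — [Balaban1988Convergent] = «[III]», (2.10)–(2.12) p. 256; [Balaban1985Variational] = «[15]», Sect. C (47)–(48) p. 285, Sect. G p. 305
# («B = (1∕i) log V»), p. 307, Prop. 9 (190) p. 309; [Balaban1987RG1] (0.4) p. 253, (0.21) p. 256; [Balaban1985Averaging] (21) p. 21: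
# THE HOLOMORPHIC LOGARITHMIC COORDINATES OF THE MULTI-SCALE DATUM — the `κ` of `B15Prop1CriticalChartFromIFT` (n07-w2's `msChart` complexified): analytic near the base datum, REAL
# on `SU(2)` data near the base, ZERO on the fibre, and INJECTIVE there (equal coordinates ⇒ `Ū(U) = Ū(Q)` on `𝔹`: the fibre transfer); plus the openness of the (0.4) guard

Honest framing: statement-level skeleton of published theorems with citation tags; proofs where landed; nothing here is a claim about the
Yang–Mills mass gap.  Cell `pub-ymgap`, HUMAN RULING D-0149 (width seats), seat `pub-ymgap-dag-n12-w1` (g2; N12 = [B15]; U1a⁺ of the w1 lineage, U1A-CENSUS §4 item 1 (δ′));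
count-neutral; N12 NOT discharged; finite 𝕋⁴ at fixed ε; nothing continuum ∕ OS ∕ mass-gap ∕ Clay.

WHY.  `B15Prop1CriticalChartFromIFT.exists_localChart_of_criticalFamily` ∕ `hMin_of_criticalFamilies` take DATUM COORDINATES `κ` on the level-0 complex configurations `Q : bond ↦ M₂(ℂ)`:
ℂ-differentiable near the base datum `↑Q₀`, real (`cF`-fixed) on the `SU(2)` data near `↑Q₀`, with `κ ↑Q₀ = Φ x₀`, and — inside the fibre transfer of `htransfer` — such that equality of
coordinates means equality of the multi-scale averages on the determining set `𝔹` ([III] (2.10) `AgreeOn`).  THIS MODULE supplies the N12 instance, characterised POINTWISE (no new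
definition): `κ Q i = logCoordC (W_j(c)⋆ · (iterMh j Q)(c))` over n07-w2's enumerated constrained bonds `(j, c)` of levels `≤ k` (`Node00.ConstrSet`∕`constrEnum`), `W` the multi-scale datum
of the fibre, `iterMh` this lineage's holomorphic averaging (= NODE 00's `Ū^j` on guarded `SU(2)` fields), `logCoordC` the holomorphic logarithmic chart of `SL₂(ℂ)` near `1` — print's
«B = (1∕i) log V» of [15] Sect. G read relative to the base datum, i.e. the complexification of n07-w2's `msChart` components.

CONTENTS (theorems only; no `def`, no `instance`, no `sorry`).  §1 THE GUARD IS OPEN in the matrix topology: `smallBelow_of_norm_loopMh_lt`, `eventually_norm_loopMh_iterMh_lt`,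
★ `eventually_smallBelow` (every `SU(N)` field whose matrix field is near that of a guarded one is guarded).  §2 `logCoordC_one`, `star_coe_mul_iterMh_coeField` (on a guarded field the
relative holomorphic average is the `SU(2)` matrix `W⋆·Ū`), ★ `datumCoord_coeField_eq_zero_of_agreeOn` (ZERO on the fibre), ★★ `eventually_analyticAt_datumCoord` ∕
`eventually_differentiableAt_datumCoord` (ANALYTIC near a guarded base datum on the fibre), ★★ `eventually_datumCoord_real` (REAL on `SU(2)` data near the base),
★★ `eventually_datumCoord_theta` (`κ ∘ θ = conj ∘ κ` near the base at invertible fields — the local equivariance along the state chart).  §3 ★★ `agreeOn_of_datumCoord_eq`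
(INJECTIVITY: equal coordinates at two guarded fields with relative averages within `1∕3` of `1` ⇒ `AgreeOn 𝔹`, for `𝔹` of levels `≤ k`), ★ `eventually_agreeOn_of_datumCoord_eq` (the same
near a pair of base fields — the fibre clause of `htransfer`).  §4 `expPointC_zero`, `expMulC_zero_left` (the state chart is centred: `expMulC 0 ↑U₀ = ↑U₀`).
-/

noncomputable section

namespace Literature.MathematicalPhysics.QuantumFieldTheory.Balaban1983to89.B15Prop1DatumCoordinates

open Set Filter
open scoped Topology ComplexConjugate
open Literature.MathematicalPhysics.QuantumFieldTheory.Balaban1983to89.Node00 (SU coeField coeField_apply SmallBelow smallBelow_succ_iff ConstrSet constrCard constrEnum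
  coe_loopHol norm_loopM_coeField_sub_one_lt star_coe_mul_coe_SU coe_mul_star_coe_SU)
open B15AveragingHolomorphic (holMh loopMh iterMh loopMh_coeField coeField_iter_eq_iterMh)
open B15AveragingAnalytic (analyticAt_holMh analyticAt_iterMh_of_polydisc analyticAt_logCoordC)
open B15SU2ChartHolomorphic (genE expPointC expMulC logCoordC logCoordC_apply expPointC_logCoordC logCoordC_theta)
open ExpMeanLog (expMeanLogSU deltaSU)
open MatrixLog (mlog mlog_one)
open BlockAveraging (Small Idx blockAvg)
open T4CubeChartGnomonic (SU2)
open T4Continuum B15DeterminingSets GaugeField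
open scoped Matrix.Norms.L2Operator

/-! ## §1  The (0.4) guard is open in the matrix topology -/

section Guard

variable {P : Params} {N : ℕ} [NeZero N]

/-- **FROM THE MATRIX INEQUALITIES TO THE GUARD**: if the holomorphic iterates of `↑U` below level `k` have loop matrices within `δ_N` of `1`, then `U` is guarded below `k`
(induction on the level: under the guard so far the holomorphic iterate IS the averaging of record, `coeField_iter_eq_iterMh`). [cite: Balaban1987RG1, (0.4) p.253, (0.21) p.256] -/
theorem smallBelow_of_norm_loopMh_lt {U : GaugeField P 0 (SU N)} :
    ∀ k, (∀ j, j < k → ∀ (c : PBond P (j + 1)) (i : Idx P), ‖loopMh (iterMh j (coeField U)) c i - 1‖ < deltaSU (Fin N)) →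
      SmallBelow (fun j => blockAvg (P := P) (j := j) expMeanLogSU) k U
  | 0, _ => fun j hj => absurd hj (Nat.not_lt_zero j)
  | k + 1, h => by
    have ih : SmallBelow (fun j => blockAvg (P := P) (j := j) expMeanLogSU) k U :=
      smallBelow_of_norm_loopMh_lt k fun j hj => h j (Nat.lt_succ_of_lt hj)
    refine smallBelow_succ_iff.2 ⟨ih, fun c i => ?_⟩
    have hm := h k (Nat.lt_succ_self k) c i
    rw [← coeField_iter_eq_iterMh k ih, loopMh_coeField, ← coe_loopHol] at hm
    exact hm

omit [NeZero N] in
/-- **THE MATRIX INEQUALITIES ARE OPEN**: strict bounds `< δ ≤ 1` on the loop matrices of the holomorphic iterates below `k` at `Q₀` persist near `Q₀` (each is a strict inequality on a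
function analytic at `Q₀`, `B15AveragingAnalytic`; finitely many). [cite: Balaban1987RG1, (0.4) p.253 (bookkeeping)] -/
theorem eventually_norm_loopMh_iterMh_lt {Q₀ : PBond P 0 → Matrix (Fin N) (Fin N) ℂ} {δ : ℝ} (hδ : δ ≤ 1) (k : ℕ)
    (h : ∀ j, j < k → ∀ (c : PBond P (j + 1)) (i : Idx P), ‖loopMh (iterMh j Q₀) c i - 1‖ < δ) :
    ∀ᶠ Q in 𝓝 Q₀, ∀ j, j < k → ∀ (c : PBond P (j + 1)) (i : Idx P), ‖loopMh (iterMh j Q) c i - 1‖ < δ := by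
  have key : ∀ j, j < k → ∀ (c : PBond P (j + 1)) (i : Idx P), ∀ᶠ Q in 𝓝 Q₀, ‖loopMh (iterMh j Q) c i - 1‖ < δ := by
    intro j hj c i
    have hit : AnalyticAt ℂ (iterMh j : (PBond P 0 → Matrix (Fin N) (Fin N) ℂ) → PBond P j → Matrix (Fin N) (Fin N) ℂ) Q₀ :=
      analyticAt_iterMh_of_polydisc j fun j' hj' c' i' => lt_of_lt_of_le (h j' (hj'.trans hj) c' i') hδ
    have hloop : AnalyticAt ℂ (fun V : PBond P j → Matrix (Fin N) (Fin N) ℂ => loopMh V c i) (iterMh j Q₀) := analyticAt_holMh _ _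
    have hc : ContinuousAt (fun Q : PBond P 0 → Matrix (Fin N) (Fin N) ℂ => ‖loopMh (iterMh j Q) c i - 1‖) Q₀ :=
      ((hloop.comp hit).continuousAt.sub continuousAt_const).norm
    exact hc.eventually (Iio_mem_nhds (h j hj c i))
  have hfin : ∀ᶠ Q in 𝓝 Q₀, ∀ j : Fin k, ∀ (c : PBond P (j + 1)) (i : Idx P), ‖loopMh (iterMh j Q) c i - 1‖ < δ :=
    eventually_all.2 fun j => eventually_all.2 fun c => eventually_all.2 fun i => key j j.2 c i
  filter_upwards [hfin] with Q hQ j hj c i using hQ ⟨j, hj⟩ c i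

/-- At a guarded `SU(N)` field the holomorphic iterates below `k` satisfy the matrix inequalities with `δ_N`. [cite: Balaban1987RG1, (0.4) p.253 (bookkeeping)] -/
theorem norm_loopMh_iterMh_lt_of_smallBelow {U : GaugeField P 0 (SU N)} {k : ℕ} (h : SmallBelow (fun j => blockAvg (P := P) (j := j) expMeanLogSU) k U) :
    ∀ j, j < k → ∀ (c : PBond P (j + 1)) (i : Idx P), ‖loopMh (iterMh j (coeField U)) c i - 1‖ < deltaSU (Fin N) := by
  intro j hj c i
  rw [← coeField_iter_eq_iterMh j (h.mono hj.le), loopMh_coeField]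
  exact norm_loopM_coeField_sub_one_lt _ c (h j hj c) i

omit [NeZero N] in
/-- `δ_N ≤ 1`. [cite: Balaban1987RG1, (0.4) p.253 (bookkeeping)] -/
theorem deltaSU_le_one : deltaSU (Fin N) ≤ 1 := by
  unfold deltaSU
  exact (min_le_left _ _).trans (by norm_num)

/-- ★ **THE GUARD IS OPEN**: near the matrix field of an `SU(N)` configuration guarded below `k`, every `SU(N)` configuration is guarded below `k`. [cite: Balaban1987RG1, (0.4) p.253, (0.21) p.256] -/
theorem eventually_smallBelow {U₀ : GaugeField P 0 (SU N)} {k : ℕ} (h : SmallBelow (fun j => blockAvg (P := P) (j := j) expMeanLogSU) k U₀) :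
    ∀ᶠ Q in 𝓝 (coeField U₀), ∀ U : GaugeField P 0 (SU N), coeField U = Q → SmallBelow (fun j => blockAvg (P := P) (j := j) expMeanLogSU) k U := by
  filter_upwards [eventually_norm_loopMh_iterMh_lt deltaSU_le_one k (norm_loopMh_iterMh_lt_of_smallBelow h)] with Q hQ U hU
  exact smallBelow_of_norm_loopMh_lt k (by rw [hU]; exact hQ)

/-- The polydisc `‖W − 1‖ < 1` for the holomorphic iterates below `k`, near a guarded `SU(N)` field (so `iterMh j`, `j ≤ k`, is analytic there). [cite: Balaban1987RG1, (0.4) p.253 (bookkeeping)] -/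
theorem eventually_polydisc {U₀ : GaugeField P 0 (SU N)} {k : ℕ} (h : SmallBelow (fun j => blockAvg (P := P) (j := j) expMeanLogSU) k U₀) :
    ∀ᶠ Q in 𝓝 (coeField U₀), ∀ j, j < k → ∀ (c : PBond P (j + 1)) (i : Idx P), ‖loopMh (iterMh j Q) c i - 1‖ < 1 :=
  eventually_norm_loopMh_iterMh_lt le_rfl k fun j hj c i =>
    lt_of_lt_of_le (norm_loopMh_iterMh_lt_of_smallBelow h j hj c i) deltaSU_le_one

end Guard

/-! ## §2  The logarithmic datum coordinates: zero on the fibre, analytic near the base, real on `SU(2)` data -/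

section Coordinates

variable {P : Params} (𝔹 : DetSet P) (k : ℕ) (W : MSField P SU2)

/-- `logCoordC 1 = 0` (`log 1 = 0`). [cite: Balaban1985Averaging, (21) p.21 (bookkeeping)] -/
theorem logCoordC_one : logCoordC (1 : Matrix (Fin 2) (Fin 2) ℂ) = 0 := by
  ext a
  rw [logCoordC_apply, mlog_one, Matrix.mul_zero, Matrix.trace_zero, mul_zero]
  rfl

/-- On a field guarded below `k`, at a level `j ≤ k`, the relative holomorphic average is the `SU(2)` matrix `W_j(c)⋆ · ↑(Ū^j(U)(c))`. [cite: Balaban1987RG1, (0.21) p.256; Balaban1988Convergent, (2.11) p.256] -/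
theorem star_coe_mul_iterMh_coeField {U : GaugeField P 0 SU2} (hsb : SmallBelow (fun j => blockAvg (P := P) (j := j) expMeanLogSU) k U) {j : ℕ} (hj : j ≤ k)
    (c : PBond P j) :
    star ((W j c : SU2) : Matrix (Fin 2) (Fin 2) ℂ) * iterMh j (coeField U) c =
      star ((W j c : SU2) : Matrix (Fin 2) (Fin 2) ℂ) * ((avgFamily (fun j => blockAvg (P := P) (j := j) expMeanLogSU) U j c : SU2) : Matrix (Fin 2) (Fin 2) ℂ) := by
  rw [← coeField_iter_eq_iterMh j (hsb.mono hj)]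
  rfl

/-- The relative matrix `W⋆ · ↑V` of two `SU(2)` elements is `θ`-fixed: `((W⋆V)⋆)⁻¹ = W⋆V`. [cite: Balaban1985Variational, p.307 (bookkeeping)] -/
theorem star_inv_relMatrix (g h : SU2) :
    (star (star ((g : SU2) : Matrix (Fin 2) (Fin 2) ℂ) * ((h : SU2) : Matrix (Fin 2) (Fin 2) ℂ)))⁻¹ =
      star ((g : SU2) : Matrix (Fin 2) (Fin 2) ℂ) * ((h : SU2) : Matrix (Fin 2) (Fin 2) ℂ) := by
  refine Matrix.inv_eq_left_inv ?_
  rw [star_mul, star_star, mul_assoc, ← mul_assoc ((h : SU2) : Matrix (Fin 2) (Fin 2) ℂ), coe_mul_star_coe_SU, one_mul, star_coe_mul_coe_SU]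

/-- The relative matrix `W⋆ · ↑V` of two `SU(2)` elements has determinant one. [cite: Balaban1985Variational, p.307 (bookkeeping)] -/
theorem det_relMatrix (g h : SU2) :
    (star ((g : SU2) : Matrix (Fin 2) (Fin 2) ℂ) * ((h : SU2) : Matrix (Fin 2) (Fin 2) ℂ)).det = 1 := by
  rw [Matrix.det_mul, Matrix.star_eq_conjTranspose, Matrix.det_conjTranspose, (Matrix.mem_specialUnitaryGroup_iff.1 g.2).2,
    (Matrix.mem_specialUnitaryGroup_iff.1 h.2).2, star_one, one_mul]

/-- The relative holomorphic average at a constrained bond is analytic near a guarded base datum and CLOSE TO `1` there (continuity; it equals `1` on the fibre).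
[cite: Balaban1987RG1, (0.4) p.253; Balaban1988Convergent, (2.11) p.256 (bookkeeping)] -/
theorem eventually_norm_rel_sub_one_lt {Q₀ : GaugeField P 0 SU2} (hsb : SmallBelow (fun j => blockAvg (P := P) (j := j) expMeanLogSU) k Q₀)
    (hW : AgreeOn 𝔹 (avgFamily (fun j => blockAvg (P := P) (j := j) expMeanLogSU) Q₀) W) {r : ℝ} (hr : 0 < r) :
    ∀ᶠ Q in 𝓝 (coeField Q₀), ∀ i : Fin (constrCard 𝔹 k),
      ‖star ((W ((constrEnum 𝔹 k).symm i).1 ((constrEnum 𝔹 k).symm i).2.1 : SU2) : Matrix (Fin 2) (Fin 2) ℂ) *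
          iterMh ((constrEnum 𝔹 k).symm i).1 Q ((constrEnum 𝔹 k).symm i).2.1 - 1‖ < r := by
  refine eventually_all.2 fun i => ?_
  set s := (constrEnum 𝔹 k).symm i with hs
  have hj : (s.1 : ℕ) ≤ k := Nat.lt_succ_iff.1 s.1.2
  have hit : AnalyticAt ℂ (iterMh (s.1 : ℕ) : (PBond P 0 → Matrix (Fin 2) (Fin 2) ℂ) → PBond P s.1 → Matrix (Fin 2) (Fin 2) ℂ) (coeField Q₀) :=
    analyticAt_iterMh_of_polydisc _ fun j' hj' c' i' =>
      lt_of_lt_of_le (norm_loopMh_iterMh_lt_of_smallBelow hsb j' (lt_of_lt_of_le hj' hj) c' i') deltaSU_le_one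
  have hev : AnalyticAt ℂ (fun V : PBond P s.1 → Matrix (Fin 2) (Fin 2) ℂ => V s.2.1) (iterMh s.1 (coeField Q₀)) :=
    (ContinuousLinearMap.proj (R := ℂ) (φ := fun _ : PBond P s.1 => Matrix (Fin 2) (Fin 2) ℂ) s.2.1).analyticAt _
  have hc : ContinuousAt (fun Q : PBond P 0 → Matrix (Fin 2) (Fin 2) ℂ =>
      ‖star ((W s.1 s.2.1 : SU2) : Matrix (Fin 2) (Fin 2) ℂ) * iterMh s.1 Q s.2.1 - 1‖) (coeField Q₀) :=
    (((continuousAt_const.mul (hev.comp hit).continuousAt)).sub continuousAt_const).norm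
  have h0 : ‖star ((W s.1 s.2.1 : SU2) : Matrix (Fin 2) (Fin 2) ℂ) * iterMh s.1 (coeField Q₀) s.2.1 - 1‖ < r := by
    rw [star_coe_mul_iterMh_coeField k W hsb hj, hW _ _ s.2.2, star_coe_mul_coe_SU, sub_self, norm_zero]
    exact hr
  exact hc.eventually (Iio_mem_nhds h0)

variable (κ : (PBond P 0 → Matrix (Fin 2) (Fin 2) ℂ) → Fin (constrCard 𝔹 k) → EuclideanSpace ℂ (Fin 3))
  (hκ : ∀ Q i, κ Q i = logCoordC (star ((W ((constrEnum 𝔹 k).symm i).1 ((constrEnum 𝔹 k).symm i).2.1 : SU2) : Matrix (Fin 2) (Fin 2) ℂ) *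
    iterMh ((constrEnum 𝔹 k).symm i).1 Q ((constrEnum 𝔹 k).symm i).2.1))
include hκ

/-- ★ **ZERO ON THE FIBRE**: at an `SU(2)` field `U` guarded below `k` whose averages agree with `W` on `𝔹`, every datum coordinate vanishes (`W⋆W = 1`, `log 1 = 0`) — so `κ ↑Q₀ = 0` at
the base datum (`W := Ū(Q₀)`) and `κ ↑U₀ = 0` at any minimiser `U₀` of that datum. [cite: Balaban1988Convergent, (2.10)–(2.12) p.256; Balaban1985Variational, Sect. C (47) p.285] -/
theorem datumCoord_coeField_eq_zero_of_agreeOn {U : GaugeField P 0 SU2} (hsb : SmallBelow (fun j => blockAvg (P := P) (j := j) expMeanLogSU) k U)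
    (hU : AgreeOn 𝔹 (avgFamily (fun j => blockAvg (P := P) (j := j) expMeanLogSU) U) W) : κ (coeField U) = 0 := by
  funext i
  rw [hκ, star_coe_mul_iterMh_coeField k W hsb (Nat.lt_succ_iff.1 ((constrEnum 𝔹 k).symm i).1.2),
    hU _ _ ((constrEnum 𝔹 k).symm i).2.2, star_coe_mul_coe_SU, logCoordC_one]
  rfl

/-- ★★ **THE DATUM COORDINATES ARE ANALYTIC NEAR A GUARDED BASE DATUM ON THE FIBRE** (the holomorphic iterate is analytic on the polydisc, which is open; the relative average stays
within `1` of `1`, where `logCoordC` is analytic). [cite: Balaban1985Variational, Sect. G p.305, Prop. 9 (190) p.309; Balaban1987RG1, (0.4) p.253; Balaban1985Averaging, (21) p.21] -/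
theorem eventually_analyticAt_datumCoord {Q₀ : GaugeField P 0 SU2} (hsb : SmallBelow (fun j => blockAvg (P := P) (j := j) expMeanLogSU) k Q₀)
    (hW : AgreeOn 𝔹 (avgFamily (fun j => blockAvg (P := P) (j := j) expMeanLogSU) Q₀) W) :
    ∀ᶠ Q in 𝓝 (coeField Q₀), AnalyticAt ℂ κ Q := by
  have hfun : κ = fun Q i => logCoordC (star ((W ((constrEnum 𝔹 k).symm i).1 ((constrEnum 𝔹 k).symm i).2.1 : SU2) : Matrix (Fin 2) (Fin 2) ℂ) *
      iterMh ((constrEnum 𝔹 k).symm i).1 Q ((constrEnum 𝔹 k).symm i).2.1) := funext fun Q => funext (hκ Q)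
  filter_upwards [eventually_polydisc hsb, eventually_norm_rel_sub_one_lt 𝔹 k W hsb hW one_pos] with Q hpoly hrel
  rw [hfun]
  refine analyticAt_pi_iff.2 fun i => ?_
  have hr := hrel i
  set s := (constrEnum 𝔹 k).symm i with hs
  have hj : (s.1 : ℕ) ≤ k := Nat.lt_succ_iff.1 s.1.2
  have hit : AnalyticAt ℂ (iterMh (s.1 : ℕ) : (PBond P 0 → Matrix (Fin 2) (Fin 2) ℂ) → PBond P s.1 → Matrix (Fin 2) (Fin 2) ℂ) Q :=
    analyticAt_iterMh_of_polydisc _ fun j' hj' c' i' => hpoly j' (lt_of_lt_of_le hj' hj) c' i'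
  have hev : AnalyticAt ℂ (fun V : PBond P s.1 → Matrix (Fin 2) (Fin 2) ℂ => V s.2.1) (iterMh s.1 Q) :=
    (ContinuousLinearMap.proj (R := ℂ) (φ := fun _ : PBond P s.1 => Matrix (Fin 2) (Fin 2) ℂ) s.2.1).analyticAt _
  have hin : AnalyticAt ℂ (fun Q : PBond P 0 → Matrix (Fin 2) (Fin 2) ℂ =>
      star ((W s.1 s.2.1 : SU2) : Matrix (Fin 2) (Fin 2) ℂ) * iterMh s.1 Q s.2.1) Q :=
    analyticAt_const.mul (hev.comp hit)
  have hlog : AnalyticAt ℂ logCoordC (star ((W s.1 s.2.1 : SU2) : Matrix (Fin 2) (Fin 2) ℂ) * iterMh s.1 Q s.2.1) :=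
    analyticAt_logCoordC hr
  exact AnalyticAt.comp (f := fun Q : PBond P 0 → Matrix (Fin 2) (Fin 2) ℂ =>
    star ((W s.1 s.2.1 : SU2) : Matrix (Fin 2) (Fin 2) ℂ) * iterMh s.1 Q s.2.1) (x := Q) hlog hin

/-- ★★ **THE DATUM COORDINATES ARE ℂ-DIFFERENTIABLE NEAR THE BASE DATUM** — the hypothesis `hκ` of `exists_localChart_of_criticalFamily`. [cite: Balaban1985Variational, Prop. 9 (190) p.309] -/
theorem eventually_differentiableAt_datumCoord {Q₀ : GaugeField P 0 SU2} (hsb : SmallBelow (fun j => blockAvg (P := P) (j := j) expMeanLogSU) k Q₀)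
    (hW : AgreeOn 𝔹 (avgFamily (fun j => blockAvg (P := P) (j := j) expMeanLogSU) Q₀) W) :
    ∀ᶠ Q in 𝓝 (coeField Q₀), DifferentiableAt ℂ κ Q := by
  filter_upwards [eventually_analyticAt_datumCoord 𝔹 k W κ hκ hsb hW] with Q hQ using hQ.differentiableAt

/-- ★★ **THE DATUM COORDINATES ARE REAL ON `SU(2)` DATA NEAR THE BASE** (coordinatewise conjugation-fixed): for `SU(2)` configurations `Q′` with `↑Q′` near `↑Q₀`, `Q′` is guarded (§1), its
relative averages `W⋆·Ū(Q′)` are `SU(2)` matrices within `1∕3` of `1`, and there `logCoordC ((A⋆)⁻¹) = conj (logCoordC A)` (`B15SU2ChartHolomorphic.logCoordC_theta`) with `(A⋆)⁻¹ = A` — the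
hypothesis `hκreal`. [cite: Balaban1985Variational, p.307, (181) p.307, Prop. 9 (190) p.309; Balaban1985Averaging, (23) p.21] -/
theorem eventually_datumCoord_real {Q₀ : GaugeField P 0 SU2} (hsb : SmallBelow (fun j => blockAvg (P := P) (j := j) expMeanLogSU) k Q₀)
    (hW : AgreeOn 𝔹 (avgFamily (fun j => blockAvg (P := P) (j := j) expMeanLogSU) Q₀) W)
    (cF : (Fin (constrCard 𝔹 k) → EuclideanSpace ℂ (Fin 3)) → Fin (constrCard 𝔹 k) → EuclideanSpace ℂ (Fin 3))
    (hcF : ∀ v i a, cF v i a = conj (v i a)) :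
    ∀ᶠ Q in 𝓝 (coeField Q₀), ∀ Q' : GaugeField P 0 SU2, coeField Q' = Q → cF (κ Q) = κ Q := by
  filter_upwards [eventually_smallBelow hsb, eventually_norm_rel_sub_one_lt 𝔹 k W hsb hW (by norm_num : (0 : ℝ) < 1 / 3)] with Q hguard hrel Q' hQ'
  have hsb' := hguard Q' hQ'
  subst hQ'
  funext i; ext a
  rw [hcF, hκ]
  set s := (constrEnum 𝔹 k).symm i with hs
  have hj : (s.1 : ℕ) ≤ k := Nat.lt_succ_iff.1 s.1.2
  have hA := star_coe_mul_iterMh_coeField k W hsb' hj s.2.1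
  have hr := (hrel i).le
  rw [hA] at hr ⊢
  have hθ := logCoordC_theta hr
  rw [star_inv_relMatrix] at hθ
  have ha := congrArg (fun v : EuclideanSpace ℂ (Fin 3) => v a) hθ
  simp only at ha
  exact ha.symm

/-- ★★ **THE DATUM COORDINATES INTERTWINE `θ` WITH COORDINATEWISE CONJUGATION NEAR THE BASE**: for `Q` near `↑Q₀` with invertible entries, `κ (θ ∘ Q) = conj ∘ κ Q` (`θ(A) = (A⋆)⁻¹`;
`iterMh` commutes with `θ` on the `1∕3`-polydisc — this seat's g0 `iterMh_theta` —, `W⋆ · θ(M) = θ(W⋆ · M)` for unitary `W`, and `logCoordC ∘ θ = conj ∘ logCoordC` within `1∕3` of `1`) — the LOCAL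
equivariance of the constraint coordinates along the state chart (symmetrise for the global form, `ConstrainedCriticalFamilySymm`). [cite: Balaban1985Variational, p.307, (181) p.307, Prop. 9 (190) p.309; Balaban1985Averaging, (23) p.21] -/
theorem eventually_datumCoord_theta {Q₀ : GaugeField P 0 SU2} (hsb : SmallBelow (fun j => blockAvg (P := P) (j := j) expMeanLogSU) k Q₀)
    (hW : AgreeOn 𝔹 (avgFamily (fun j => blockAvg (P := P) (j := j) expMeanLogSU) Q₀) W)
    (cF : (Fin (constrCard 𝔹 k) → EuclideanSpace ℂ (Fin 3)) → Fin (constrCard 𝔹 k) → EuclideanSpace ℂ (Fin 3))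
    (hcF : ∀ v i a, cF v i a = conj (v i a)) :
    ∀ᶠ Q in 𝓝 (coeField Q₀), (∀ b, IsUnit (Q b).det) → κ (fun b => (star (Q b))⁻¹) = cF (κ Q) := by
  have h3 : ∀ j, j < k → ∀ (c : PBond P (j + 1)) (i : Idx P), ‖loopMh (iterMh j (coeField Q₀)) c i - 1‖ < 1 / 3 := fun j hj c i =>
    lt_of_lt_of_le (norm_loopMh_iterMh_lt_of_smallBelow hsb j hj c i) (by unfold deltaSU; exact min_le_left _ _)
  filter_upwards [eventually_norm_loopMh_iterMh_lt (by norm_num : (1 : ℝ) / 3 ≤ 1) k h3,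
    eventually_norm_rel_sub_one_lt 𝔹 k W hsb hW (by norm_num : (0 : ℝ) < 1 / 3)] with Q hpoly hrel hunit
  funext i; ext a
  rw [hcF, hκ, hκ]
  have hr := (hrel i).le
  set s := (constrEnum 𝔹 k).symm i with hs
  have hj : (s.1 : ℕ) ≤ k := Nat.lt_succ_iff.1 s.1.2
  have hθ : iterMh (s.1 : ℕ) (fun b => (star (Q b))⁻¹) = fun b => (star (iterMh (s.1 : ℕ) Q b))⁻¹ :=
    B15AveragingHolomorphic.iterMh_theta hunit _ fun j' hj' c' i' => (hpoly j' (lt_of_lt_of_le hj' hj) c' i').le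
  have hWinv : (((W s.1 s.2.1 : SU2) : Matrix (Fin 2) (Fin 2) ℂ))⁻¹ = star ((W s.1 s.2.1 : SU2) : Matrix (Fin 2) (Fin 2) ℂ) :=
    Matrix.inv_eq_left_inv (star_coe_mul_coe_SU _)
  have hprod : star ((W s.1 s.2.1 : SU2) : Matrix (Fin 2) (Fin 2) ℂ) * (star (iterMh (s.1 : ℕ) Q s.2.1))⁻¹ =
      (star (star ((W s.1 s.2.1 : SU2) : Matrix (Fin 2) (Fin 2) ℂ) * iterMh (s.1 : ℕ) Q s.2.1))⁻¹ := by
    rw [B15AveragingHolomorphic.star_inv_mul_star_inv, star_star, hWinv]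
  rw [hθ, hprod, logCoordC_theta hr]

end Coordinates

/-! ## §3  Injectivity on the fibre side: equal coordinates ⇒ equal averages on `𝔹` (the fibre transfer) -/

section Injective

variable {P : Params} (𝔹 : DetSet P) (k : ℕ) (W : MSField P SU2)
  (κ : (PBond P 0 → Matrix (Fin 2) (Fin 2) ℂ) → Fin (constrCard 𝔹 k) → EuclideanSpace ℂ (Fin 3))
  (hκ : ∀ Q i, κ Q i = logCoordC (star ((W ((constrEnum 𝔹 k).symm i).1 ((constrEnum 𝔹 k).symm i).2.1 : SU2) : Matrix (Fin 2) (Fin 2) ℂ) *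
    iterMh ((constrEnum 𝔹 k).symm i).1 Q ((constrEnum 𝔹 k).symm i).2.1))
include hκ

/-- ★★ **EQUAL COORDINATES ⇒ EQUAL AVERAGES ON `𝔹`**: for a determining set of levels `≤ k`, two `SU(2)` fields guarded below `k` whose relative averages at the constrained bonds lie within
`1∕3` of `1` and whose datum coordinates coincide have the same multi-scale averages on `𝔹` (`expPointC ∘ logCoordC = id` on small `SL₂(ℂ)`, `B15SU2ChartHolomorphic.expPointC_logCoordC`;
cancel the unitary `W⋆`). [cite: Balaban1988Convergent, (2.10)–(2.11) p.256; Balaban1985Averaging, (21) p.21 («It is an inverse to the exponential function»); Balaban1985Variational, Sect. C (47)–(48) p.285] -/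
theorem agreeOn_of_datumCoord_eq (h𝔹 : ∀ j, k < j → 𝔹 j = ∅) {U Q' : GaugeField P 0 SU2}
    (hsbU : SmallBelow (fun j => blockAvg (P := P) (j := j) expMeanLogSU) k U) (hsbQ : SmallBelow (fun j => blockAvg (P := P) (j := j) expMeanLogSU) k Q')
    (hrU : ∀ i : Fin (constrCard 𝔹 k), ‖star ((W ((constrEnum 𝔹 k).symm i).1 ((constrEnum 𝔹 k).symm i).2.1 : SU2) : Matrix (Fin 2) (Fin 2) ℂ) *
      iterMh ((constrEnum 𝔹 k).symm i).1 (coeField U) ((constrEnum 𝔹 k).symm i).2.1 - 1‖ ≤ 1 / 3)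
    (hrQ : ∀ i : Fin (constrCard 𝔹 k), ‖star ((W ((constrEnum 𝔹 k).symm i).1 ((constrEnum 𝔹 k).symm i).2.1 : SU2) : Matrix (Fin 2) (Fin 2) ℂ) *
      iterMh ((constrEnum 𝔹 k).symm i).1 (coeField Q') ((constrEnum 𝔹 k).symm i).2.1 - 1‖ ≤ 1 / 3)
    (heq : κ (coeField U) = κ (coeField Q')) :
    AgreeOn 𝔹 (avgFamily (fun j => blockAvg (P := P) (j := j) expMeanLogSU) U) (avgFamily (fun j => blockAvg (P := P) (j := j) expMeanLogSU) Q') := by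
  intro j c hc
  by_cases hjk : k < j
  · rw [h𝔹 j hjk] at hc
    simp [bondsOf] at hc
  have hj : j ≤ k := Nat.le_of_not_lt hjk
  let s₀ : ConstrSet 𝔹 k := ⟨⟨j, Nat.lt_succ_of_le hj⟩, c, hc⟩
  have hi := congrFun heq (constrEnum 𝔹 k s₀)
  rw [hκ, hκ, Equiv.symm_apply_apply] at hi
  have hrU' := hrU (constrEnum 𝔹 k s₀)
  have hrQ' := hrQ (constrEnum 𝔹 k s₀)
  rw [Equiv.symm_apply_apply] at hrU' hrQ'
  change logCoordC (star ((W j c : SU2) : Matrix (Fin 2) (Fin 2) ℂ) * iterMh j (coeField U) c) =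
    logCoordC (star ((W j c : SU2) : Matrix (Fin 2) (Fin 2) ℂ) * iterMh j (coeField Q') c) at hi
  change ‖star ((W j c : SU2) : Matrix (Fin 2) (Fin 2) ℂ) * iterMh j (coeField U) c - 1‖ ≤ 1 / 3 at hrU'
  change ‖star ((W j c : SU2) : Matrix (Fin 2) (Fin 2) ℂ) * iterMh j (coeField Q') c - 1‖ ≤ 1 / 3 at hrQ'
  rw [star_coe_mul_iterMh_coeField k W hsbU hj] at hi hrU'
  rw [star_coe_mul_iterMh_coeField k W hsbQ hj] at hi hrQ'
  have hmat : star ((W j c : SU2) : Matrix (Fin 2) (Fin 2) ℂ) * ((avgFamily (fun j => blockAvg (P := P) (j := j) expMeanLogSU) U j c : SU2) : Matrix (Fin 2) (Fin 2) ℂ) =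
      star ((W j c : SU2) : Matrix (Fin 2) (Fin 2) ℂ) * ((avgFamily (fun j => blockAvg (P := P) (j := j) expMeanLogSU) Q' j c : SU2) : Matrix (Fin 2) (Fin 2) ℂ) := by
    rw [← expPointC_logCoordC hrU' (det_relMatrix _ _), ← expPointC_logCoordC hrQ' (det_relMatrix _ _), hi]
  have hcancel := congrArg (fun M => ((W j c : SU2) : Matrix (Fin 2) (Fin 2) ℂ) * M) hmat
  simp only [← mul_assoc, coe_mul_star_coe_SU, one_mul] at hcancel
  exact Subtype.ext hcancel

/-- ★ **THE FIBRE TRANSFER NEAR A PAIR OF BASE FIELDS**: near `(↑U₀, ↑Q₀)`, with `U₀`, `Q₀` guarded below `k` and both on the fibre of `W` (e.g. `W = Ū(Q₀)` and `U₀` a minimiser of that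
datum), any two `SU(2)` fields `U′`, `Q′` with those matrix fields and EQUAL datum coordinates have equal averages on `𝔹` — the fibre clause of `htransfer`. [cite: Balaban1988Convergent, (2.10)–(2.12) p.256; Balaban1985Variational, Sect. C (47)–(48) p.285, Prop. 9 p.309] -/
theorem eventually_agreeOn_of_datumCoord_eq (h𝔹 : ∀ j, k < j → 𝔹 j = ∅) {U₀ Q₀ : GaugeField P 0 SU2}
    (hsbU : SmallBelow (fun j => blockAvg (P := P) (j := j) expMeanLogSU) k U₀) (hsbQ : SmallBelow (fun j => blockAvg (P := P) (j := j) expMeanLogSU) k Q₀)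
    (hU : AgreeOn 𝔹 (avgFamily (fun j => blockAvg (P := P) (j := j) expMeanLogSU) U₀) W) (hQ : AgreeOn 𝔹 (avgFamily (fun j => blockAvg (P := P) (j := j) expMeanLogSU) Q₀) W) :
    ∀ᶠ w in 𝓝 (coeField U₀, coeField Q₀), ∀ U' Q' : GaugeField P 0 SU2, coeField U' = w.1 → coeField Q' = w.2 → κ w.1 = κ w.2 →
      AgreeOn 𝔹 (avgFamily (fun j => blockAvg (P := P) (j := j) expMeanLogSU) U') (avgFamily (fun j => blockAvg (P := P) (j := j) expMeanLogSU) Q') := by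
  have h3 : (0 : ℝ) < 1 / 3 := by norm_num
  have hU' := (eventually_smallBelow hsbU).and (eventually_norm_rel_sub_one_lt 𝔹 k W hsbU hU h3)
  have hQ' := (eventually_smallBelow hsbQ).and (eventually_norm_rel_sub_one_lt 𝔹 k W hsbQ hQ h3)
  filter_upwards [hU'.prod_nhds hQ'] with w hw U' Q' hU'w hQ'w heq
  obtain ⟨⟨hgU, hrU⟩, ⟨hgQ, hrQ⟩⟩ := hw
  refine agreeOn_of_datumCoord_eq 𝔹 k W κ hκ h𝔹 (hgU U' hU'w) (hgQ Q' hQ'w) (fun i => ?_) (fun i => ?_) (by rw [hU'w, hQ'w]; exact heq)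
  · rw [hU'w]; exact (hrU i).le
  · rw [hQ'w]; exact (hrQ i).le

end Injective

/-! ## §4  The state chart is centred -/

section Centre

variable {P : Params} {j : ℕ}

/-- `expPointC 0 = 1`. [cite: Balaban1989LargeFieldII, (1.19) p.360 (bookkeeping)] -/
theorem expPointC_zero : expPointC 0 = 1 := by
  rw [expPointC]
  simp

/-- **THE STATE CHART IS CENTRED**: `expMulC 0 W = W` (so `χ 0 = ↑U₀`, the base state is `x₀ = 0`, real). [cite: Balaban1985Variational, Sect. G p.305 (bookkeeping)] -/
theorem expMulC_zero_left (W : PBond P j → Matrix (Fin 2) (Fin 2) ℂ) : expMulC (0 : VecField P j (EuclideanSpace ℂ (Fin 3))) W = W := by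
  funext b
  show expPointC ((0 : VecField P j (EuclideanSpace ℂ (Fin 3))) b) * W b = W b
  rw [Pi.zero_apply, expPointC_zero, one_mul]

end Centre

end Literature.MathematicalPhysics.QuantumFieldTheory.Balaban1983to89.B15Prop1DatumCoordinates

end
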